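import Literature.Computability.Cryptography.PeriodFindingCosetPoisson
import Literature.Computability.Cryptography.PeriodFindingNestedDigits
import HarnessLib

/-!
# The window energy of the box character sum of one coset

Topic `Computability/Cryptography` (harmonic analysis of period finding over `ℤ^T`); theorem-only file, no named facts.
Assembles `PeriodFindingCosetPoisson.lean` (character expansion of a coset sum; nontrivial characters move a unit vector)
and `PeriodFindingNestedDigits.lean` (exact energy, per-coordinate window tails and window counts of nested digit kernels).

Setting: a finite-index subgroup `Λ ≤ ℤ^T` (`h = |ℤ^T/Λ|`), a coset `g`, base angles `x : Fin T → ℝ`, a character `χ₀` with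
angles `η₀` (`χ₀(ē_t) = e(η₀ t)`), and the frequencies `ν < M^T` of a `T`-digit register, coordinate `t` seeing the angle
`x_t + ν/M^{T−t}`. The WINDOW of `χ₀` is the set of `ν` for which every coordinate angle `x_t + η₀ t + ν/M^{T−t}` is within
`u` grid steps `1/M` of an integer. Main result:

* `coset_window_energy_ge` — `∑_{ν ∈ window} |∑_{e ∈ [0,M)^T, ē = g} e(θ_ν·e)|² ≥ (M^{2T}/h²)(1 − T/(u−2) − 2h²(2u)^T/M)`
  for `u ≥ 3` and `u/M ≤ 1/(4h)`: EVERY coset alone puts mass `≈ 1/h` (relative to the trivial bound `M^{2T}/h`… see the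
  consuming law file) near the peak of EVERY character — the approximate Poisson summation behind the uniformity of the
  hidden-coset samples of Hallgren's class-group algorithm. [Hallgren2005, §4]

## References

* S. Hallgren, STOC 2005, §4. [Hallgren2005]
* A. Yu. Kitaev, arXiv:quant-ph/9511026 (1995), §4. [Kitaev1995]
-/

noncomputable section

namespace Literature.Computability.Cryptography

namespace PeriodFinding

open Complex Finset

variable {T : ℕ}

/-! ### One-dimensional factors -/

/-- `e1 θ m · w^m = (e(θ) w)^m`. [folklore] -/
theorem e1_mul_pow (θ : ℝ) (w : ℂ) (m : ℕ) : e1 θ m * w ^ m = (cexp (2 * Real.pi * I * (θ : ℂ)) * w) ^ m := by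
  unfold e1
  rw [mul_pow, ← Complex.exp_nat_mul]
  congr 2
  push_cast
  ring

/-- With the peak character angle: `e1 θ m · e(η)^m = e1 (θ + η) m`. [folklore] -/
theorem e1_mul_exp_pow (θ η : ℝ) (m : ℕ) :
    e1 θ m * cexp (2 * Real.pi * I * (η : ℂ)) ^ m = e1 (θ + η) m := by
  unfold e1
  rw [← Complex.exp_nat_mul, ← Complex.exp_add]
  congr 1
  push_cast
  ring

/-- A unit-circle geometric sum has norm `≤ M`. [folklore] -/
theorem norm_sum_pow_le {z : ℂ} (hz : ‖z‖ = 1) (M : ℕ) : ‖∑ m ∈ range M, z ^ m‖ ≤ M := by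
  calc ‖∑ m ∈ range M, z ^ m‖ ≤ ∑ m ∈ range M, ‖z ^ m‖ := norm_sum_le _ _
    _ = M := by simp [norm_pow, hz]

/-- A geometric progression on the unit circle: `|∑_{m<M} zᵐ| ≤ 2/|z − 1|`. [folklore] -/
theorem norm_sum_pow_le_div {z : ℂ} (hz : ‖z‖ = 1) (hz1 : z ≠ 1) (M : ℕ) :
    ‖∑ m ∈ range M, z ^ m‖ ≤ 2 / ‖z - 1‖ := by
  rw [geom_sum_eq hz1, norm_div]
  gcongr
  exact (norm_sub_le _ _).trans (by rw [norm_pow, hz, one_pow, norm_one]; norm_num)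

/-- `|e(f) − 1| ≤ 2π min(fract f, 1 − fract f)`. [folklore] -/
theorem norm_exp_sub_one_le (f : ℝ) :
    ‖cexp (2 * Real.pi * I * (f : ℂ)) - 1‖ ≤ 2 * Real.pi * min (Int.fract f) (1 - Int.fract f) := by
  -- reduce to the fractional part
  have hred : cexp (2 * Real.pi * I * (f : ℂ)) = cexp (2 * Real.pi * I * ((Int.fract f : ℝ) : ℂ)) := by
    conv_lhs => rw [← Int.fract_add_floor f]
    push_cast
    rw [mul_add, Complex.exp_add, show 2 * (Real.pi : ℂ) * I * (⌊f⌋ : ℂ) = (⌊f⌋ : ℂ) * (2 * Real.pi * I) by ring,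
      Complex.exp_int_mul_two_pi_mul_I, mul_one]
  rw [hred]
  set g : ℝ := Int.fract f
  have hg0 : 0 ≤ g := Int.fract_nonneg f
  have hg1 : g < 1 := Int.fract_lt_one f
  have hnorm : ‖cexp (2 * Real.pi * I * ((g : ℝ) : ℂ)) - 1‖ = 2 * |Real.sin (Real.pi * g)| := by
    rw [show 2 * (Real.pi : ℂ) * I * ((g : ℝ) : ℂ) = I * ((2 * Real.pi * g : ℝ) : ℂ) by push_cast; ring,
      Complex.norm_exp_I_mul_ofReal_sub_one, show (2 * Real.pi * g : ℝ) / 2 = Real.pi * g by ring,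
      Real.norm_eq_abs, abs_mul, abs_two]
  rw [hnorm]
  -- `|sin(π g)| ≤ π min(g, 1 − g)`
  have h1 : |Real.sin (Real.pi * g)| ≤ Real.pi * g := by
    calc |Real.sin (Real.pi * g)| ≤ |Real.pi * g| := Real.abs_sin_le_abs
      _ = Real.pi * g := abs_of_nonneg (by positivity)
  have h2 : |Real.sin (Real.pi * g)| ≤ Real.pi * (1 - g) := by
    rw [show Real.pi * g = Real.pi - Real.pi * (1 - g) by ring, Real.sin_pi_sub]
    calc |Real.sin (Real.pi * (1 - g))| ≤ |Real.pi * (1 - g)| := Real.abs_sin_le_abs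
      _ = Real.pi * (1 - g) := abs_of_nonneg (by nlinarith [Real.pi_pos])
  rcases le_total g (1 - g) with h | h
  · rw [min_eq_left h]; linarith
  · rw [min_eq_right h]; linarith

/-! ### The window energy -/

/-- **The window energy of the box character sum of one coset.** For `u ≥ 3` and `u/M ≤ 1/(4h)`:
`∑_{ν ∈ window(χ₀)} |∑_{e ∈ [0,M)^T, ē = g} e(θ_ν·e)|² ≥ (M^{2T}/h²)·(1 − T/(u−2) − 2h²(2u)^T/M)`,
`θ_ν t = x t + ν/M^{T−t}`, the window being `∀ t, M·‖x t + η₀ t + ν/M^{T−t}‖ < u`. Proof: expand the coset sum over the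
characters (`boxCosetSum_eq`); the term of `χ₀` is the nested digit kernel with base angles `x + η₀`, of total energy
`M^{2T}` and off-window energy `≤ T·M^{2T}/(u−2)` (`sum_norm_sq_nested`, `sum_norm_sq_nested_offWindow`); every other
character is moved by `≥ 4/h` in some unit vector (`exists_norm_one_sub_apply_single_ge`), so inside the window one of its
factors is `≤ h` and its product `≤ h M^{T−1}`; the cross term over the `≤ (2u)^T` window points (`card_nestedWindow_le`)
is `≤ 2h²(2u)^T M^{2T}/M` after the division by `h²`. [cite: Hallgren2005, §4] -/
theorem coset_window_energy_ge (hT : 0 < T) (M : ℕ) (hM : 0 < M) (Λ : AddSubgroup (Fin T → ℤ))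
    [Fintype ((Fin T → ℤ) ⧸ Λ)] [DecidableEq ((Fin T → ℤ) ⧸ Λ)]
    (g : (Fin T → ℤ) ⧸ Λ) (x : Fin T → ℝ) (χ₀ : AddChar ((Fin T → ℤ) ⧸ Λ) ℂ) (η₀ : Fin T → ℝ)
    (hη₀ : ∀ t : Fin T, χ₀ (QuotientAddGroup.mk (Pi.single t 1)) = cexp (2 * Real.pi * I * (η₀ t : ℂ)))
    {u : ℕ} (hu : 3 ≤ u) (huM : (u : ℝ) / M ≤ 1 / (4 * Fintype.card ((Fin T → ℤ) ⧸ Λ))) :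
    ((M : ℝ) ^ (2 * T) / (Fintype.card ((Fin T → ℤ) ⧸ Λ) : ℝ) ^ 2) *
        (1 - (T : ℝ) / (u - 2) - 2 * (Fintype.card ((Fin T → ℤ) ⧸ Λ) : ℝ) ^ 2 * (2 * u) ^ T / M) ≤
      ∑ ν ∈ (range (M ^ T)).filter (fun ν : ℕ => ∀ t : Fin T, (M : ℝ) *
          min (Int.fract (x t + η₀ t + (ν : ℝ) / (M : ℝ) ^ (T - (t : ℕ))))
            (1 - Int.fract (x t + η₀ t + (ν : ℝ) / (M : ℝ) ^ (T - (t : ℕ)))) < u),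
        ‖∑ e ∈ (boxT T M).filter (fun e => (QuotientAddGroup.mk (toZ e) : (Fin T → ℤ) ⧸ Λ) = g),
            eR (fun t => x t + (ν : ℝ) / (M : ℝ) ^ (T - (t : ℕ))) (toZ e)‖ ^ 2 := by
  classical
  set h : ℕ := Fintype.card ((Fin T → ℤ) ⧸ Λ) with hh
  have hhpos : 0 < h := Fintype.card_pos
  have hhR : (0 : ℝ) < h := by exact_mod_cast hhpos
  have hhC : (h : ℂ) ≠ 0 := by exact_mod_cast hhpos.ne'
  have hMR : (0 : ℝ) < M := by exact_mod_cast hM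
  -- notation: angles, the kernel products of the characters, the rest
  set θ : ℕ → Fin T → ℝ := fun ν t => x t + (ν : ℝ) / (M : ℝ) ^ (T - (t : ℕ)) with hθ
  set P : AddChar ((Fin T → ℤ) ⧸ Λ) ℂ → ℕ → ℂ := fun χ ν =>
    ∏ t : Fin T, ∑ m ∈ range M, e1 (θ ν t) m * χ (QuotientAddGroup.mk (Pi.single t 1)) ^ m with hP
  set R : ℕ → ℂ := fun ν => ∑ χ ∈ univ.erase χ₀, χ (-g) * P χ ν with hR
  -- base angles of the peak character, as a function on `ℕ`
  set x' : ℕ → ℝ := fun t => if ht : t < T then x ⟨t, ht⟩ + η₀ ⟨t, ht⟩ else 0 with hx'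
  have hx'fin : ∀ t : Fin T, x' t = x t + η₀ t := fun t => by simp [hx', t.isLt]
  -- the window predicate in both forms
  set Wnd : ℕ → Prop := fun ν => ∀ t : Fin T, (M : ℝ) *
      min (Int.fract (x t + η₀ t + (ν : ℝ) / (M : ℝ) ^ (T - (t : ℕ))))
        (1 - Int.fract (x t + η₀ t + (ν : ℝ) / (M : ℝ) ^ (T - (t : ℕ)))) < u with hWnd
  have hWnd_iff : ∀ ν : ℕ, Wnd ν ↔ ∀ t < T, (M : ℝ) *
      min (Int.fract (x' t + (ν : ℝ) / (M : ℝ) ^ (T - t))) (1 - Int.fract (x' t + (ν : ℝ) / (M : ℝ) ^ (T - t))) < u := by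
    intro ν
    constructor
    · intro hw t ht
      have := hw ⟨t, ht⟩
      rw [← hx'fin ⟨t, ht⟩] at this
      exact this
    · intro hw t
      have := hw t t.isLt
      rw [hx'fin t] at this
      exact this
  -- Step 1: the character expansion of the coset sum
  have hexp : ∀ ν : ℕ, (∑ e ∈ (boxT T M).filter (fun e => (QuotientAddGroup.mk (toZ e) : (Fin T → ℤ) ⧸ Λ) = g),
      eR (θ ν) (toZ e)) = (1 / (h : ℂ)) * (χ₀ (-g) * P χ₀ ν + R ν) := by
    intro ν
    rw [boxCosetSum_eq Λ M (θ ν) g, ← Finset.add_sum_erase univ _ (mem_univ χ₀)]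
  -- Step 2: the peak character's product is the nested digit kernel with base angles `x'`
  have hP₀ : ∀ ν : ℕ, P χ₀ ν = ∏ t ∈ range T, ∑ m ∈ range M, e1 (x' t + (ν : ℝ) / (M : ℝ) ^ (T - t)) m := by
    intro ν
    simp only [hP]
    rw [← Fin.prod_univ_eq_prod_range (fun t => ∑ m ∈ range M, e1 (x' t + (ν : ℝ) / (M : ℝ) ^ (T - t)) m) T]
    refine prod_congr rfl fun t _ => sum_congr rfl fun m _ => ?_
    rw [hη₀ t, e1_mul_exp_pow, hx'fin t]
    simp only [hθ]
    ring_nf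
  -- Step 3: the other characters are small inside the window
  have hPχ : ∀ ν : ℕ, Wnd ν → ∀ χ : AddChar ((Fin T → ℤ) ⧸ Λ) ℂ, χ ≠ χ₀ →
      ‖P χ ν‖ ≤ h * (M : ℝ) ^ (T - 1) := by
    intro ν hw χ hχ
    -- the separating unit vector
    have hψ : χ - χ₀ ≠ 0 := sub_ne_zero.2 hχ
    obtain ⟨t₀, ht₀⟩ := exists_norm_one_sub_apply_single_ge Λ (χ - χ₀) hψ
    rw [← hh] at ht₀
    -- each factor is a unit-circle geometric sum
    have hz1 : ∀ t : Fin T, ‖cexp (2 * Real.pi * I * ((θ ν t : ℝ) : ℂ)) * χ (QuotientAddGroup.mk (Pi.single t 1))‖ = 1 := by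
      intro t
      rw [norm_mul, AddChar.norm_apply, mul_one,
        show 2 * (Real.pi : ℂ) * I * ((θ ν t : ℝ) : ℂ) = ((2 * Real.pi * θ ν t : ℝ) : ℂ) * I by push_cast; ring]
      exact Complex.norm_exp_ofReal_mul_I _
    have hfac : ∀ t : Fin T, ‖∑ m ∈ range M, e1 (θ ν t) m * χ (QuotientAddGroup.mk (Pi.single t 1)) ^ m‖ ≤ M := by
      intro t
      simp_rw [e1_mul_pow]
      exact norm_sum_pow_le (hz1 t) M
    -- the special factor
    have hspec : ‖∑ m ∈ range M, e1 (θ ν t₀) m * χ (QuotientAddGroup.mk (Pi.single t₀ 1)) ^ m‖ ≤ h := by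
      simp_rw [e1_mul_pow]
      set z₀ : ℂ := cexp (2 * Real.pi * I * (((θ ν t₀ + η₀ t₀ : ℝ)) : ℂ)) with hz₀
      set ρ : ℂ := (χ - χ₀) (QuotientAddGroup.mk (Pi.single t₀ 1)) with hρ
      have hzρ : cexp (2 * Real.pi * I * ((θ ν t₀ : ℝ) : ℂ)) * χ (QuotientAddGroup.mk (Pi.single t₀ 1)) = z₀ * ρ := by
        rw [hρ, AddChar.sub_apply, AddChar.map_neg_eq_inv, hη₀ t₀, hz₀,
          show (((θ ν t₀ + η₀ t₀ : ℝ)) : ℂ) = ((θ ν t₀ : ℝ) : ℂ) + ((η₀ t₀ : ℝ) : ℂ) by push_cast; ring,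
          mul_add, Complex.exp_add]
        have hne : cexp (2 * Real.pi * I * ((η₀ t₀ : ℝ) : ℂ)) ≠ 0 := Complex.exp_ne_zero _
        field_simp
      rw [hzρ]
      have hρ1 : ‖ρ‖ = 1 := AddChar.norm_apply _ _
      have hz₀1 : ‖z₀‖ = 1 := by
        rw [hz₀, show 2 * (Real.pi : ℂ) * I * (((θ ν t₀ + η₀ t₀ : ℝ)) : ℂ) = ((2 * Real.pi * (θ ν t₀ + η₀ t₀) : ℝ) : ℂ) * I by
          push_cast; ring]
        exact Complex.norm_exp_ofReal_mul_I _
      -- `‖z₀ − 1‖ ≤ 2π u/M ≤ π/(2h)` inside the window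
      have hz₀sub : ‖z₀ - 1‖ ≤ Real.pi / (2 * h) := by
        have hwin := hw t₀
        have hle := norm_exp_sub_one_le (θ ν t₀ + η₀ t₀)
        have hmin : min (Int.fract (θ ν t₀ + η₀ t₀)) (1 - Int.fract (θ ν t₀ + η₀ t₀)) < (u : ℝ) / M := by
          rw [lt_div_iff₀ hMR]
          have : x t₀ + η₀ t₀ + (ν : ℝ) / (M : ℝ) ^ (T - (t₀ : ℕ)) = θ ν t₀ + η₀ t₀ := by simp only [hθ]; ring
          rw [this] at hwin
          linarith
        have hposmin : 0 ≤ min (Int.fract (θ ν t₀ + η₀ t₀)) (1 - Int.fract (θ ν t₀ + η₀ t₀)) :=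
          le_min (Int.fract_nonneg _) (by linarith [Int.fract_lt_one (θ ν t₀ + η₀ t₀)])
        calc ‖z₀ - 1‖ ≤ 2 * Real.pi * min (Int.fract (θ ν t₀ + η₀ t₀)) (1 - Int.fract (θ ν t₀ + η₀ t₀)) := by
              rw [hz₀]; exact hle
          _ ≤ 2 * Real.pi * ((u : ℝ) / M) := by gcongr
          _ ≤ 2 * Real.pi * (1 / (4 * h)) := by gcongr
          _ = Real.pi / (2 * h) := by ring
      -- hence `‖z₀ρ − 1‖ ≥ 4/h − π/(2h) ≥ 2/h`
      have hsep : (2 : ℝ) / h ≤ ‖z₀ * ρ - 1‖ := by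
        have h1 : ‖(1 : ℂ) - ρ‖ ≤ ‖z₀ - 1‖ + ‖z₀ * ρ - 1‖ := by
          calc ‖(1 : ℂ) - ρ‖ = ‖(z₀ - 1) * ρ - (z₀ * ρ - 1)‖ := by ring_nf
            _ ≤ ‖(z₀ - 1) * ρ‖ + ‖z₀ * ρ - 1‖ := norm_sub_le _ _
            _ = ‖z₀ - 1‖ + ‖z₀ * ρ - 1‖ := by rw [norm_mul, hρ1, mul_one]
        have hpi4 : Real.pi ≤ 4 := Real.pi_le_four
        have : (4 : ℝ) / h - Real.pi / (2 * h) ≤ ‖z₀ * ρ - 1‖ := by linarith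
        have h84 : (2 : ℝ) / h ≤ 4 / h - Real.pi / (2 * h) := by
          rw [show (4 : ℝ) / h - Real.pi / (2 * h) = (8 - Real.pi) / (2 * h) by field_simp; ring,
            div_le_div_iff₀ hhR (by positivity)]
          nlinarith
        exact h84.trans this
      have hzρne : z₀ * ρ ≠ 1 := by
        intro heq
        rw [heq, sub_self, norm_zero] at hsep
        have : (0 : ℝ) < 2 / h := by positivity
        linarith
      have hzρ1 : ‖z₀ * ρ‖ = 1 := by rw [norm_mul, hz₀1, hρ1, mul_one]
      calc ‖∑ m ∈ range M, (z₀ * ρ) ^ m‖ ≤ 2 / ‖z₀ * ρ - 1‖ := norm_sum_pow_le_div hzρ1 hzρne M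
        _ ≤ 2 / (2 / h) := div_le_div_of_nonneg_left (by norm_num) (by positivity) hsep
        _ = h := by field_simp
    -- the product
    simp only [hP]
    rw [norm_prod, ← Finset.mul_prod_erase univ _ (mem_univ t₀)]
    have hrest : ∏ t ∈ univ.erase t₀, ‖∑ m ∈ range M, e1 (θ ν t) m * χ (QuotientAddGroup.mk (Pi.single t 1)) ^ m‖ ≤
        (M : ℝ) ^ (T - 1) := by
      calc _ ≤ ∏ t ∈ univ.erase t₀, (M : ℝ) := prod_le_prod (fun t _ => norm_nonneg _) (fun t _ => hfac t)
        _ = (M : ℝ) ^ (T - 1) := by rw [prod_const, card_erase_of_mem (mem_univ t₀), card_univ, Fintype.card_fin]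
    calc _ ≤ (h : ℝ) * (M : ℝ) ^ (T - 1) :=
          mul_le_mul hspec hrest (prod_nonneg fun t _ => norm_nonneg _) hhR.le
      _ = _ := rfl
  -- Step 4: the rest is small inside the window; the peak product is at most `M^T`
  have hRle : ∀ ν : ℕ, Wnd ν → ‖R ν‖ ≤ (h : ℝ) ^ 2 * (M : ℝ) ^ (T - 1) := by
    intro ν hw
    simp only [hR]
    calc ‖∑ χ ∈ univ.erase χ₀, χ (-g) * P χ ν‖ ≤ ∑ χ ∈ univ.erase χ₀, ‖χ (-g) * P χ ν‖ := norm_sum_le _ _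
      _ ≤ ∑ χ ∈ univ.erase χ₀, (h : ℝ) * (M : ℝ) ^ (T - 1) := by
          refine sum_le_sum fun χ hχ => ?_
          rw [norm_mul, AddChar.norm_apply, one_mul]
          exact hPχ ν hw χ (ne_of_mem_erase hχ)
      _ = ((univ.erase χ₀).card : ℝ) * ((h : ℝ) * (M : ℝ) ^ (T - 1)) := by rw [sum_const, nsmul_eq_mul]
      _ ≤ (h : ℝ) * ((h : ℝ) * (M : ℝ) ^ (T - 1)) := by
          gcongr
          have : (univ.erase χ₀).card ≤ h := by
            rw [card_erase_of_mem (mem_univ χ₀), card_univ, AddChar.card_eq, ← hh]; omega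
          exact_mod_cast this
      _ = _ := by ring
  have hP₀le : ∀ ν : ℕ, ‖P χ₀ ν‖ ≤ (M : ℝ) ^ T := by
    intro ν
    simp only [hP]
    rw [norm_prod]
    have hz1 : ∀ t : Fin T, ‖cexp (2 * Real.pi * I * ((θ ν t : ℝ) : ℂ)) * χ₀ (QuotientAddGroup.mk (Pi.single t 1))‖ = 1 := by
      intro t
      rw [norm_mul, AddChar.norm_apply, mul_one,
        show 2 * (Real.pi : ℂ) * I * ((θ ν t : ℝ) : ℂ) = ((2 * Real.pi * θ ν t : ℝ) : ℂ) * I by push_cast; ring]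
      exact Complex.norm_exp_ofReal_mul_I _
    calc _ ≤ ∏ t : Fin T, (M : ℝ) := prod_le_prod (fun t _ => norm_nonneg _) (fun t _ => by
            simp_rw [e1_mul_pow]; exact norm_sum_pow_le (hz1 t) M)
      _ = (M : ℝ) ^ T := by rw [prod_const, card_univ, Fintype.card_fin]
  -- Step 5: pointwise lower bound inside the window
  have hpt : ∀ ν : ℕ, Wnd ν →
      (1 / (h : ℝ) ^ 2) * ‖P χ₀ ν‖ ^ 2 - 2 * (M : ℝ) ^ (2 * T) / M ≤
        ‖∑ e ∈ (boxT T M).filter (fun e => (QuotientAddGroup.mk (toZ e) : (Fin T → ℤ) ⧸ Λ) = g), eR (θ ν) (toZ e)‖ ^ 2 := by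
    intro ν hw
    rw [hexp ν, show (1 / (h : ℂ)) * (χ₀ (-g) * P χ₀ ν + R ν) = (1 / (h : ℂ)) * (χ₀ (-g) * P χ₀ ν) + (1 / (h : ℂ)) * R ν by ring]
    have hge := norm_sq_add_ge ((1 / (h : ℂ)) * (χ₀ (-g) * P χ₀ ν)) ((1 / (h : ℂ)) * R ν)
    have hna : ‖(1 / (h : ℂ)) * (χ₀ (-g) * P χ₀ ν)‖ = ‖P χ₀ ν‖ / h := by
      rw [norm_mul, norm_mul, AddChar.norm_apply, one_mul, norm_div, norm_one, Complex.norm_natCast]; ring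
    have hnr : ‖(1 / (h : ℂ)) * R ν‖ = ‖R ν‖ / h := by
      rw [norm_mul, norm_div, norm_one, Complex.norm_natCast]; ring
    rw [hna, hnr] at hge
    have hRν := hRle ν hw
    have hPν := hP₀le ν
    have hM1 : (M : ℝ) ^ (T - 1) * M ≤ (M : ℝ) ^ T := by
      rw [← pow_succ, Nat.sub_add_cancel hT]
    -- `2 (‖P‖/h)(‖R‖/h) ≤ 2 M^T h² M^{T-1}/h² = 2 M^{2T}/M`
    have hcross : 2 * (‖P χ₀ ν‖ / h) * (‖R ν‖ / h) ≤ 2 * (M : ℝ) ^ (2 * T) / M := by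
      have h1 : ‖P χ₀ ν‖ * ‖R ν‖ ≤ (M : ℝ) ^ T * ((h : ℝ) ^ 2 * (M : ℝ) ^ (T - 1)) :=
        mul_le_mul hPν hRν (norm_nonneg _) (by positivity)
      have h2 : (M : ℝ) ^ T * ((h : ℝ) ^ 2 * (M : ℝ) ^ (T - 1)) * M ≤ (h : ℝ) ^ 2 * (M : ℝ) ^ (2 * T) := by
        calc _ = (h : ℝ) ^ 2 * (M : ℝ) ^ T * ((M : ℝ) ^ (T - 1) * M) := by ring
          _ ≤ (h : ℝ) ^ 2 * (M : ℝ) ^ T * (M : ℝ) ^ T := by gcongr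
          _ = _ := by ring
      rw [show 2 * (‖P χ₀ ν‖ / h) * (‖R ν‖ / h) = 2 * (‖P χ₀ ν‖ * ‖R ν‖) / (h : ℝ) ^ 2 by field_simp,
        div_le_div_iff₀ (by positivity) hMR]
      nlinarith [h1, h2, norm_nonneg (P χ₀ ν), norm_nonneg (R ν)]
    have hsq : (1 / (h : ℝ) ^ 2) * ‖P χ₀ ν‖ ^ 2 = (‖P χ₀ ν‖ / h) ^ 2 := by rw [div_pow]; ring
    calc (1 / (h : ℝ) ^ 2) * ‖P χ₀ ν‖ ^ 2 - 2 * (M : ℝ) ^ (2 * T) / M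
        ≤ (‖P χ₀ ν‖ / h) ^ 2 - 2 * (‖P χ₀ ν‖ / h) * (‖R ν‖ / h) := by rw [← hsq]; linarith [hcross]
      _ ≤ _ := hge
  -- Step 6: sum over the window
  set Wf := (range (M ^ T)).filter (fun ν : ℕ => Wnd ν) with hWf
  have hmain : (M : ℝ) ^ (2 * T) * (1 - (T : ℝ) / (u - 2)) ≤ ∑ ν ∈ Wf, ‖P χ₀ ν‖ ^ 2 := by
    -- total energy minus the off-window energy of each coordinate
    have htot : ∑ ν ∈ range (M ^ T), ‖P χ₀ ν‖ ^ 2 = (M : ℝ) ^ (2 * T) := by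
      simp_rw [hP₀]; exact sum_norm_sq_nested M hM T x'
    have hoff : ∀ t < T, ∑ ν ∈ (range (M ^ T)).filter (fun ν : ℕ => (u : ℝ) ≤ M *
        min (Int.fract (x' t + (ν : ℝ) / (M : ℝ) ^ (T - t))) (1 - Int.fract (x' t + (ν : ℝ) / (M : ℝ) ^ (T - t)))),
          ‖P χ₀ ν‖ ^ 2 ≤ (M : ℝ) ^ (2 * T) / (u - 2) := by
      intro t ht
      simp_rw [hP₀]
      exact sum_norm_sq_nested_offWindow M hM hu T x' t ht
    -- the complement of the window is covered by the off-window sets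
    have hcompl : ∑ ν ∈ (range (M ^ T)).filter (fun ν : ℕ => ¬ Wnd ν), ‖P χ₀ ν‖ ^ 2 ≤
        ∑ t ∈ range T, ∑ ν ∈ (range (M ^ T)).filter (fun ν : ℕ => (u : ℝ) ≤ M *
          min (Int.fract (x' t + (ν : ℝ) / (M : ℝ) ^ (T - t))) (1 - Int.fract (x' t + (ν : ℝ) / (M : ℝ) ^ (T - t)))),
            ‖P χ₀ ν‖ ^ 2 := by
      have hrhs : (∑ t ∈ range T, ∑ ν ∈ (range (M ^ T)).filter (fun ν : ℕ => (u : ℝ) ≤ M *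
          min (Int.fract (x' t + (ν : ℝ) / (M : ℝ) ^ (T - t))) (1 - Int.fract (x' t + (ν : ℝ) / (M : ℝ) ^ (T - t)))),
            ‖P χ₀ ν‖ ^ 2) = ∑ ν ∈ range (M ^ T), ∑ t ∈ range T, (if (u : ℝ) ≤ M *
          min (Int.fract (x' t + (ν : ℝ) / (M : ℝ) ^ (T - t))) (1 - Int.fract (x' t + (ν : ℝ) / (M : ℝ) ^ (T - t)))
            then ‖P χ₀ ν‖ ^ 2 else 0) := by
        rw [sum_comm]
        exact sum_congr rfl fun t _ => by rw [sum_filter]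
      rw [hrhs, sum_filter]
      refine sum_le_sum fun ν _ => ?_
      by_cases hw : Wnd ν
      · rw [if_neg (not_not_intro hw)]
        exact sum_nonneg fun t _ => by split_ifs <;> positivity
      · rw [if_pos hw]
        have hw' : ∃ t, t < T ∧ (u : ℝ) ≤ M *
            min (Int.fract (x' t + (ν : ℝ) / (M : ℝ) ^ (T - t))) (1 - Int.fract (x' t + (ν : ℝ) / (M : ℝ) ^ (T - t))) := by
          rw [hWnd_iff] at hw
          push Not at hw
          obtain ⟨t, ht, hle⟩ := hw
          exact ⟨t, ht, hle⟩
        obtain ⟨t, ht, hle⟩ := hw'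
        calc ‖P χ₀ ν‖ ^ 2 = (if (u : ℝ) ≤ M *
              min (Int.fract (x' t + (ν : ℝ) / (M : ℝ) ^ (T - t))) (1 - Int.fract (x' t + (ν : ℝ) / (M : ℝ) ^ (T - t)))
              then ‖P χ₀ ν‖ ^ 2 else 0) := by rw [if_pos hle]
          _ ≤ ∑ t' ∈ range T, (if (u : ℝ) ≤ M *
              min (Int.fract (x' t' + (ν : ℝ) / (M : ℝ) ^ (T - t'))) (1 - Int.fract (x' t' + (ν : ℝ) / (M : ℝ) ^ (T - t')))
              then ‖P χ₀ ν‖ ^ 2 else 0) :=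
            single_le_sum (f := fun t' => if (u : ℝ) ≤ M *
              min (Int.fract (x' t' + (ν : ℝ) / (M : ℝ) ^ (T - t'))) (1 - Int.fract (x' t' + (ν : ℝ) / (M : ℝ) ^ (T - t')))
              then ‖P χ₀ ν‖ ^ 2 else 0) (fun t' _ => by split_ifs <;> positivity) (mem_range.2 ht)
    have hsplit : ∑ ν ∈ range (M ^ T), ‖P χ₀ ν‖ ^ 2 =
        ∑ ν ∈ Wf, ‖P χ₀ ν‖ ^ 2 + ∑ ν ∈ (range (M ^ T)).filter (fun ν : ℕ => ¬ Wnd ν), ‖P χ₀ ν‖ ^ 2 := by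
      rw [hWf, ← sum_filter_add_sum_filter_not (range (M ^ T)) (fun ν : ℕ => Wnd ν)]
    have hT : ∑ t ∈ range T, ∑ ν ∈ (range (M ^ T)).filter (fun ν : ℕ => (u : ℝ) ≤ M *
          min (Int.fract (x' t + (ν : ℝ) / (M : ℝ) ^ (T - t))) (1 - Int.fract (x' t + (ν : ℝ) / (M : ℝ) ^ (T - t)))),
            ‖P χ₀ ν‖ ^ 2 ≤ T * ((M : ℝ) ^ (2 * T) / (u - 2)) := by
      calc _ ≤ ∑ t ∈ range T, (M : ℝ) ^ (2 * T) / (u - 2) := sum_le_sum fun t ht => hoff t (mem_range.1 ht)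
        _ = _ := by rw [sum_const, card_range, nsmul_eq_mul]
    have : (M : ℝ) ^ (2 * T) - T * ((M : ℝ) ^ (2 * T) / (u - 2)) ≤ ∑ ν ∈ Wf, ‖P χ₀ ν‖ ^ 2 := by
      linarith [hcompl.trans hT, hsplit, htot]
    calc (M : ℝ) ^ (2 * T) * (1 - (T : ℝ) / (u - 2)) = (M : ℝ) ^ (2 * T) - T * ((M : ℝ) ^ (2 * T) / (u - 2)) := by ring
      _ ≤ _ := this
  have hcard : (Wf.card : ℝ) ≤ (2 * u : ℝ) ^ T := by
    have := card_nestedWindow_le M hM u T x'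
    have hle : Wf.card ≤ (2 * u) ^ T := by
      refine le_trans (le_of_eq ?_) this
      rw [hWf]; congr 1; exact filter_congr fun ν _ => hWnd_iff ν
    exact_mod_cast hle
  calc ((M : ℝ) ^ (2 * T) / (h : ℝ) ^ 2) * (1 - (T : ℝ) / (u - 2) - 2 * (h : ℝ) ^ 2 * (2 * u) ^ T / M)
      = (1 / (h : ℝ) ^ 2) * ((M : ℝ) ^ (2 * T) * (1 - (T : ℝ) / (u - 2))) - (2 * u : ℝ) ^ T * (2 * (M : ℝ) ^ (2 * T) / M) := by
        field_simp
    _ ≤ (1 / (h : ℝ) ^ 2) * (∑ ν ∈ Wf, ‖P χ₀ ν‖ ^ 2) - (Wf.card : ℝ) * (2 * (M : ℝ) ^ (2 * T) / M) := by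
        gcongr
    _ = ∑ ν ∈ Wf, ((1 / (h : ℝ) ^ 2) * ‖P χ₀ ν‖ ^ 2 - 2 * (M : ℝ) ^ (2 * T) / M) := by
        rw [sum_sub_distrib, ← mul_sum, sum_const, nsmul_eq_mul]
    _ ≤ ∑ ν ∈ Wf, ‖∑ e ∈ (boxT T M).filter (fun e => (QuotientAddGroup.mk (toZ e) : (Fin T → ℤ) ⧸ Λ) = g),
          eR (θ ν) (toZ e)‖ ^ 2 := sum_le_sum fun ν hν => hpt ν (mem_filter.1 hν).2

end PeriodFinding

end Literature.Computability.Cryptography
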